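import Mathlib
import Summits.Ventures.PercRepro2.HCov

/-!
# Scaled transport of the covariance form on the admissible configurations (blind cell PercRepro2,
typer-1 g57)

Every reduction of the weighted lane that kills a pattern through `Q = {a₁ ↮ a₂}` has the same
shape: a configuration map `Ψ` from the instance `(p, ends)` to a smaller instance `(q, ends')`,
a set `G` of ADMISSIBLE configurations containing every `Q`-configuration, a set `G'` on the target
containing every `Q`-configuration there, a constant `c` with

  `P_p(Ψ⁻¹ Y ∩ G) = c · P_q(Y ∩ G')`  for every event `Y`   (the scaled pushforward),

and the agreement of the connectivity between the five marks on `G`. The root pair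
(`RootPair.Gc_rootPair`: `Ψ = id`, `G = {e closed}`, `G' = univ`, `c = 1 − p_e`) and the hat
(`Hat.Gc_hat`: `Ψ = hatMap`, `G = HatG e₁ e₂`, `G' = HatG e₂ e₃`, `c = hatC`) were proved mass
by mass. This file proves the common statement ONCE:

* **`prob_scale_of_good`** — an admissible event carried by `Ψ` scales by `c`;
* **`prob_Q_inter_scale`**, **`prob_PD_inter_scale`**, **`prob_T_inter_scale`**,
  **`prob_T'_inter_scale`** — the `Q`-, `PD`-, `T`-, `T′`-restricted masses of any event carried
  by `Ψ` scale by `c`;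
* **`Gc_scale`** — **`Gc p ends = c³ · Gc q ends'`** whenever the marks `o, a₃, b` are carried
  (the roots always are); every mass of `Gc` is `Q`-restricted (the gap by `gap_eq_Q`), `Gc` is
  cubic in the masses;
* `GcTransportScaledInstances.lean` re-derives the two landed identities from `Gc_scale` in a few
  lines each (`Gc_hat_of_scale`, `Gc_rootPair_of_scale`): the pushforward and the connectivity
  agreement are all a reduction has to supply.

The next `Q`-killed reduction (a mark-free block whose terminals are the two roots and one further
vertex, the bundles of the typed lane) is therefore its pushforward identity plus its connectivity
lemma; `Gc_scale` does the rest. Standard axioms.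
-/

namespace Summit.Ventures.PercRepro2

open CovForm

namespace Scale

section Transport

variable {V : Type*} {E : Type*} [Fintype E] [DecidableEq E] [DecidableEq V] {R : Type*} [Field R]

omit [DecidableEq V] in
/-- An admissible event carried by `Ψ` scales by `c`: if `X ⊆ G`, `X' ⊆ G'` and, on `G`,
`ω ∈ X ↔ Ψ ω ∈ X'`, then `P_p(X) = c · P_q(X')`. -/
lemma prob_scale_of_good {p q : E → R} {Ψ : Config E → Config E} {G G' : Set (Config E)} {c : R}
    (hP : ∀ Y : Set (Config E), prob p (Ψ ⁻¹' Y ∩ G) = c * prob q (Y ∩ G'))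
    {X X' : Set (Config E)} (hXX : ∀ ω ∈ G, ω ∈ X ↔ Ψ ω ∈ X') (hXG : X ⊆ G) (hXG' : X' ⊆ G') :
    prob p X = c * prob q X' := by
  have h1 : X = Ψ ⁻¹' X' ∩ G := by
    ext ω
    constructor
    · intro hω
      exact ⟨(hXX ω (hXG hω)).1 hω, hXG hω⟩
    · rintro ⟨hω, hG⟩
      exact (hXX ω hG).2 hω
  have h2 : X' = X' ∩ G' := (Set.inter_eq_left.2 hXG').symm
  rw [h1, hP, ← h2]

/-- The hypotheses of a `Q`-killed reduction: the scaled pushforward, the admissibility of the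
`Q`-configurations on both sides, and the agreement of the connectivity between the vertices of
`M` on the admissible configurations. -/
structure IsScaledTransport (p q : E → R) (ends ends' : E → Sym2 V) (Ψ : Config E → Config E)
    (G G' : Set (Config E)) (c : R) (a₁ a₂ : V) (M : Set V) : Prop where
  /-- `P_p(Ψ⁻¹ Y ∩ G) = c · P_q(Y ∩ G')` for every event `Y`. -/
  push : ∀ Y : Set (Config E), prob p (Ψ ⁻¹' Y ∩ G) = c * prob q (Y ∩ G')
  /-- A `Q`-configuration of the instance is admissible. -/
  memG : ∀ ω, ¬ Conn ends ω a₁ a₂ → ω ∈ G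
  /-- A `Q`-configuration of the target is admissible. -/
  memG' : ∀ ω, ¬ Conn ends' ω a₁ a₂ → ω ∈ G'
  /-- On the admissible configurations `Ψ` carries the connectivity between the vertices of `M`. -/
  conn : ∀ ω ∈ G, ∀ x ∈ M, ∀ z ∈ M, Conn ends ω x z ↔ Conn ends' (Ψ ω) x z
  /-- `a₁ ∈ M`. -/
  mem₁ : a₁ ∈ M
  /-- `a₂ ∈ M`. -/
  mem₂ : a₂ ∈ M

variable {p q : E → R} {ends ends' : E → Sym2 V} {Ψ : Config E → Config E} {G G' : Set (Config E)}
  {c : R} {a₁ a₂ : V} {M : Set V}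

omit [DecidableEq V] in
/-- A `Q`-configuration is admissible (`Q = avoidAll a₂ {a₁}`). -/
lemma mem_G_of_mem_Q (h : IsScaledTransport p q ends ends' Ψ G G' c a₁ a₂ M) {ω : Config E}
    (hω : ω ∈ avoidAll ends a₂ {a₁}) : ω ∈ G :=
  h.memG ω fun hc => hω a₁ (Finset.mem_singleton_self a₁) (conn_symm hc)

omit [DecidableEq V] in
/-- A `Q`-configuration of the target is admissible. -/
lemma mem_G'_of_mem_Q (h : IsScaledTransport p q ends ends' Ψ G G' c a₁ a₂ M) {ω : Config E}
    (hω : ω ∈ avoidAll ends' a₂ {a₁}) : ω ∈ G' :=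
  h.memG' ω fun hc => hω a₁ (Finset.mem_singleton_self a₁) (conn_symm hc)

omit [DecidableEq V] in
/-- On `G`, membership in a connection event between vertices of `M` is carried. -/
lemma mem_connEvent_iff (h : IsScaledTransport p q ends ends' Ψ G G' c a₁ a₂ M) {ω : Config E}
    (hω : ω ∈ G) {x z : V} (hx : x ∈ M) (hz : z ∈ M) :
    ω ∈ connEvent ends x z ↔ Ψ ω ∈ connEvent ends' x z := by
  simp only [mem_connEvent]
  exact h.conn ω hω x hx z hz

omit [DecidableEq V] in
/-- On `G`, membership in `Q` is carried. -/
lemma mem_Q_iff (h : IsScaledTransport p q ends ends' Ψ G G' c a₁ a₂ M) {ω : Config E}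
    (hω : ω ∈ G) : ω ∈ avoidAll ends a₂ {a₁} ↔ Ψ ω ∈ avoidAll ends' a₂ {a₁} := by
  simp only [avoidAll, Set.mem_setOf_eq, Finset.mem_singleton, forall_eq,
    h.conn ω hω a₂ h.mem₂ a₁ h.mem₁]

omit [DecidableEq V] in
/-- On `G`, membership in `PD` is carried (`a₃ ∈ M`). -/
lemma mem_PD_iff (h : IsScaledTransport p q ends ends' Ψ G G' c a₁ a₂ M) {ω : Config E}
    (hω : ω ∈ G) {a₃ : V} (h3 : a₃ ∈ M) :
    ω ∈ PDEvent ends a₁ a₂ a₃ ↔ Ψ ω ∈ PDEvent ends' a₁ a₂ a₃ := by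
  simp only [PDEvent, Dtilde, UnionCluster.inU, Set.mem_inter_iff, Set.mem_compl_iff,
    Set.mem_union, mem_connEvent, h.conn ω hω a₁ h.mem₁ a₂ h.mem₂, h.conn ω hω a₃ h3 a₁ h.mem₁,
    h.conn ω hω a₃ h3 a₂ h.mem₂]

omit [DecidableEq V] in
/-- On `G`, membership in `T = TEvent a₁ a₂ a₃` is carried. -/
lemma mem_T_iff (h : IsScaledTransport p q ends ends' Ψ G G' c a₁ a₂ M) {ω : Config E}
    (hω : ω ∈ G) {a₃ : V} (h3 : a₃ ∈ M) :
    ω ∈ TEvent ends a₁ a₂ a₃ ↔ Ψ ω ∈ TEvent ends' a₁ a₂ a₃ := by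
  simp only [TEvent, Set.mem_inter_iff, Set.mem_compl_iff, mem_connEvent,
    h.conn ω hω a₂ h.mem₂ a₁ h.mem₁, h.conn ω hω a₂ h.mem₂ a₃ h3]

omit [DecidableEq V] in
/-- On `G`, membership in `T′ = TEvent a₂ a₁ a₃` is carried. -/
lemma mem_T'_iff (h : IsScaledTransport p q ends ends' Ψ G G' c a₁ a₂ M) {ω : Config E}
    (hω : ω ∈ G) {a₃ : V} (h3 : a₃ ∈ M) :
    ω ∈ TEvent ends a₂ a₁ a₃ ↔ Ψ ω ∈ TEvent ends' a₂ a₁ a₃ := by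
  simp only [TEvent, Set.mem_inter_iff, Set.mem_compl_iff, mem_connEvent,
    h.conn ω hω a₁ h.mem₁ a₂ h.mem₂, h.conn ω hω a₁ h.mem₁ a₃ h3]

omit [Fintype E] [DecidableEq E] [DecidableEq V] in
/-- `PD ⊆ Q`. -/
lemma PD_subset_Q (ends : E → Sym2 V) (a₁ a₂ a₃ : V) :
    PDEvent ends a₁ a₂ a₃ ⊆ avoidAll ends a₂ {a₁} := by
  intro ω hω
  simp only [avoidAll, Set.mem_setOf_eq, Finset.mem_singleton, forall_eq]
  exact fun hc => hω.1 (conn_symm hc)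

omit [Fintype E] [DecidableEq E] [DecidableEq V] in
/-- `T ⊆ Q`. -/
lemma T_subset_Q (ends : E → Sym2 V) (a₁ a₂ a₃ : V) :
    TEvent ends a₁ a₂ a₃ ⊆ avoidAll ends a₂ {a₁} := by
  intro ω hω
  simp only [avoidAll, Set.mem_setOf_eq, Finset.mem_singleton, forall_eq]
  exact hω.1

omit [Fintype E] [DecidableEq E] [DecidableEq V] in
/-- `T′ ⊆ Q`. -/
lemma T'_subset_Q (ends : E → Sym2 V) (a₁ a₂ a₃ : V) :
    TEvent ends a₂ a₁ a₃ ⊆ avoidAll ends a₂ {a₁} := by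
  intro ω hω
  simp only [avoidAll, Set.mem_setOf_eq, Finset.mem_singleton, forall_eq]
  exact fun hc => hω.1 (conn_symm hc)

omit [DecidableEq V] in
/-- **A `Q`-restricted mass scales**: `P_p(Q ∩ X) = c · P_q(Q ∩ X')` for events `X, X'` carried
by `Ψ` on `G`. -/
lemma prob_Q_inter_scale (h : IsScaledTransport p q ends ends' Ψ G G' c a₁ a₂ M)
    {X X' : Set (Config E)} (hXX : ∀ ω ∈ G, ω ∈ X ↔ Ψ ω ∈ X') :
    prob p (avoidAll ends a₂ {a₁} ∩ X) = c * prob q (avoidAll ends' a₂ {a₁} ∩ X') := by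
  refine prob_scale_of_good h.push ?_ ?_ ?_
  · intro ω hω
    rw [Set.mem_inter_iff, Set.mem_inter_iff, mem_Q_iff h hω, hXX ω hω]
  · exact fun ω hω => mem_G_of_mem_Q h hω.1
  · exact fun ω hω => mem_G'_of_mem_Q h hω.1

omit [DecidableEq V] in
/-- **A `PD`-restricted mass scales.** -/
lemma prob_PD_inter_scale (h : IsScaledTransport p q ends ends' Ψ G G' c a₁ a₂ M) {a₃ : V}
    (h3 : a₃ ∈ M) {X X' : Set (Config E)} (hXX : ∀ ω ∈ G, ω ∈ X ↔ Ψ ω ∈ X') :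
    prob p (PDEvent ends a₁ a₂ a₃ ∩ X) = c * prob q (PDEvent ends' a₁ a₂ a₃ ∩ X') := by
  refine prob_scale_of_good h.push ?_ ?_ ?_
  · intro ω hω
    rw [Set.mem_inter_iff, Set.mem_inter_iff, mem_PD_iff h hω h3, hXX ω hω]
  · exact fun ω hω => mem_G_of_mem_Q h (PD_subset_Q ends a₁ a₂ a₃ hω.1)
  · exact fun ω hω => mem_G'_of_mem_Q h (PD_subset_Q ends' a₁ a₂ a₃ hω.1)

omit [DecidableEq V] in
/-- **A `T`-restricted mass scales.** -/
lemma prob_T_inter_scale (h : IsScaledTransport p q ends ends' Ψ G G' c a₁ a₂ M) {a₃ : V}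
    (h3 : a₃ ∈ M) {X X' : Set (Config E)} (hXX : ∀ ω ∈ G, ω ∈ X ↔ Ψ ω ∈ X') :
    prob p (TEvent ends a₁ a₂ a₃ ∩ X) = c * prob q (TEvent ends' a₁ a₂ a₃ ∩ X') := by
  refine prob_scale_of_good h.push ?_ ?_ ?_
  · intro ω hω
    rw [Set.mem_inter_iff, Set.mem_inter_iff, mem_T_iff h hω h3, hXX ω hω]
  · exact fun ω hω => mem_G_of_mem_Q h (T_subset_Q ends a₁ a₂ a₃ hω.1)
  · exact fun ω hω => mem_G'_of_mem_Q h (T_subset_Q ends' a₁ a₂ a₃ hω.1)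

omit [DecidableEq V] in
/-- **A `T′`-restricted mass scales.** -/
lemma prob_T'_inter_scale (h : IsScaledTransport p q ends ends' Ψ G G' c a₁ a₂ M) {a₃ : V}
    (h3 : a₃ ∈ M) {X X' : Set (Config E)} (hXX : ∀ ω ∈ G, ω ∈ X ↔ Ψ ω ∈ X') :
    prob p (TEvent ends a₂ a₁ a₃ ∩ X) = c * prob q (TEvent ends' a₂ a₁ a₃ ∩ X') := by
  refine prob_scale_of_good h.push ?_ ?_ ?_
  · intro ω hω
    rw [Set.mem_inter_iff, Set.mem_inter_iff, mem_T'_iff h hω h3, hXX ω hω]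
  · exact fun ω hω => mem_G_of_mem_Q h (T'_subset_Q ends a₁ a₂ a₃ hω.1)
  · exact fun ω hω => mem_G'_of_mem_Q h (T'_subset_Q ends' a₁ a₂ a₃ hω.1)

omit [DecidableEq V] in
/-- `P(Q)` scales. -/
lemma prob_Q_scale (h : IsScaledTransport p q ends ends' Ψ G G' c a₁ a₂ M) :
    prob p (avoidAll ends a₂ {a₁}) = c * prob q (avoidAll ends' a₂ {a₁}) := by
  have := prob_Q_inter_scale h (X := Set.univ) (X' := Set.univ) fun _ _ => Iff.rfl
  simpa only [Set.inter_univ] using this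

omit [DecidableEq V] in
/-- `P(PD)` scales. -/
lemma prob_PD_scale (h : IsScaledTransport p q ends ends' Ψ G G' c a₁ a₂ M) {a₃ : V}
    (h3 : a₃ ∈ M) : prob p (PDEvent ends a₁ a₂ a₃) = c * prob q (PDEvent ends' a₁ a₂ a₃) := by
  have := prob_PD_inter_scale h h3 (X := Set.univ) (X' := Set.univ) fun _ _ => Iff.rfl
  simpa only [Set.inter_univ] using this

omit [DecidableEq V] in
/-- `P(T)` scales. -/
lemma prob_T_scale (h : IsScaledTransport p q ends ends' Ψ G G' c a₁ a₂ M) {a₃ : V}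
    (h3 : a₃ ∈ M) : prob p (TEvent ends a₁ a₂ a₃) = c * prob q (TEvent ends' a₁ a₂ a₃) := by
  have := prob_T_inter_scale h h3 (X := Set.univ) (X' := Set.univ) fun _ _ => Iff.rfl
  simpa only [Set.inter_univ] using this

omit [DecidableEq V] in
/-- `P(T′)` scales. -/
lemma prob_T'_scale (h : IsScaledTransport p q ends ends' Ψ G G' c a₁ a₂ M) {a₃ : V}
    (h3 : a₃ ∈ M) : prob p (TEvent ends a₂ a₁ a₃) = c * prob q (TEvent ends' a₂ a₁ a₃) := by
  have := prob_T'_inter_scale h h3 (X := Set.univ) (X' := Set.univ) fun _ _ => Iff.rfl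
  simpa only [Set.inter_univ] using this

end Transport

/-! ## The masses of `Gc` -/

section Masses

variable {V : Type*} {E : Type*} [Fintype E] [DecidableEq E] [DecidableEq V] {R : Type*} [Field R]
  {p q : E → R} {ends ends' : E → Sym2 V} {Ψ : Config E → Config E} {G G' : Set (Config E)}
  {c : R} {a₁ a₂ : V} {M : Set V}

omit [DecidableEq V] in
/-- A single connection event between vertices of `M` is carried on `G`. -/
lemma conn1_iff (h : IsScaledTransport p q ends ends' Ψ G G' c a₁ a₂ M) {x z : V} (hx : x ∈ M)
    (hz : z ∈ M) : ∀ ω ∈ G, ω ∈ connEvent ends x z ↔ Ψ ω ∈ connEvent ends' x z :=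
  fun _ hω => mem_connEvent_iff h hω hx hz

omit [DecidableEq V] in
/-- An intersection of two connection events between vertices of `M` is carried on `G`. -/
lemma conn2_iff (h : IsScaledTransport p q ends ends' Ψ G G' c a₁ a₂ M) {x z x' z' : V}
    (hx : x ∈ M) (hz : z ∈ M) (hx' : x' ∈ M) (hz' : z' ∈ M) :
    ∀ ω ∈ G, ω ∈ connEvent ends x z ∩ connEvent ends x' z' ↔
      Ψ ω ∈ connEvent ends' x z ∩ connEvent ends' x' z' :=
  fun ω hω => by
    simp only [Set.mem_inter_iff, mem_connEvent_iff h hω hx hz, mem_connEvent_iff h hω hx' hz']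

variable (h : IsScaledTransport p q ends ends' Ψ G G' c a₁ a₂ M) {o a₃ b : V}
include h

omit [DecidableEq V] in
/-- `E_Q[σ_b σ_o]` scales. -/
lemma EQbo_scale (ho : o ∈ M) (hb : b ∈ M) : EQbo p ends o a₁ a₂ b = c * EQbo q ends' o a₁ a₂ b := by
  unfold EQbo
  rw [prob_Q_inter_scale h (conn2_iff h h.mem₁ ho h.mem₁ hb),
    prob_Q_inter_scale h (conn2_iff h h.mem₂ ho h.mem₂ hb),
    prob_Q_inter_scale h (conn2_iff h h.mem₂ ho h.mem₁ hb),
    prob_Q_inter_scale h (conn2_iff h h.mem₁ ho h.mem₂ hb)]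
  ring

omit [DecidableEq V] in
/-- `E_Q[σ_b σ₃]` scales. -/
lemma EQb3_scale (h3 : a₃ ∈ M) (hb : b ∈ M) :
    EQb3 p ends a₁ a₂ a₃ b = c * EQb3 q ends' a₁ a₂ a₃ b := by
  unfold EQb3
  rw [prob_T'_inter_scale h h3 (conn1_iff h h.mem₁ hb),
    prob_T_inter_scale h h3 (conn1_iff h h.mem₂ hb),
    prob_T_inter_scale h h3 (conn1_iff h h.mem₁ hb),
    prob_T'_inter_scale h h3 (conn1_iff h h.mem₂ hb)]
  ring

omit [DecidableEq V] in
/-- `E_Q[σ_b σ₃ 1_{o ∈ U}]` scales. -/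
lemma EQb3o_scale (ho : o ∈ M) (h3 : a₃ ∈ M) (hb : b ∈ M) :
    EQb3o p ends o a₁ a₂ a₃ b = c * EQb3o q ends' o a₁ a₂ a₃ b := by
  unfold EQb3o
  rw [prob_T'_inter_scale h h3 (conn2_iff h h.mem₁ ho h.mem₁ hb),
    prob_T'_inter_scale h h3 (conn2_iff h h.mem₂ ho h.mem₁ hb),
    prob_T_inter_scale h h3 (conn2_iff h h.mem₁ ho h.mem₂ hb),
    prob_T_inter_scale h h3 (conn2_iff h h.mem₂ ho h.mem₂ hb),
    prob_T_inter_scale h h3 (conn2_iff h h.mem₁ ho h.mem₁ hb),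
    prob_T_inter_scale h h3 (conn2_iff h h.mem₂ ho h.mem₁ hb),
    prob_T'_inter_scale h h3 (conn2_iff h h.mem₁ ho h.mem₂ hb),
    prob_T'_inter_scale h h3 (conn2_iff h h.mem₂ ho h.mem₂ hb)]
  ring

omit [DecidableEq V] in
/-- `E_Q[σ_o]` scales. -/
lemma EQo_scale (ho : o ∈ M) : EQo p ends o a₁ a₂ = c * EQo q ends' o a₁ a₂ := by
  unfold EQo
  rw [prob_Q_inter_scale h (conn1_iff h h.mem₁ ho), prob_Q_inter_scale h (conn1_iff h h.mem₂ ho)]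
  ring

omit [DecidableEq V] in
/-- `E_Q[σ₃]` scales. -/
lemma EQ3_scale (h3 : a₃ ∈ M) : EQ3 p ends a₁ a₂ a₃ = c * EQ3 q ends' a₁ a₂ a₃ := by
  unfold EQ3
  rw [prob_T'_scale h h3, prob_T_scale h h3]
  ring

omit [DecidableEq V] in
/-- `E_Q[σ₃ 1_{o ∈ U}]` scales. -/
lemma EQ3o_scale (ho : o ∈ M) (h3 : a₃ ∈ M) :
    EQ3o p ends o a₁ a₂ a₃ = c * EQ3o q ends' o a₁ a₂ a₃ := by
  unfold EQ3o
  rw [prob_T'_inter_scale h h3 (conn1_iff h h.mem₁ ho),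
    prob_T'_inter_scale h h3 (conn1_iff h h.mem₂ ho),
    prob_T_inter_scale h h3 (conn1_iff h h.mem₁ ho),
    prob_T_inter_scale h h3 (conn1_iff h h.mem₂ ho)]
  ring

omit [DecidableEq V] in
/-- `P(PD, b ∈ U)` scales. -/
lemma PDb_scale (h3 : a₃ ∈ M) (hb : b ∈ M) :
    PDb p ends a₁ a₂ a₃ b = c * PDb q ends' a₁ a₂ a₃ b := by
  unfold PDb
  rw [prob_PD_inter_scale h h3 (conn1_iff h h.mem₁ hb),
    prob_PD_inter_scale h h3 (conn1_iff h h.mem₂ hb)]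
  ring

omit [DecidableEq V] in
/-- `P(PD, b ∈ U, o ∈ U)` scales. -/
lemma PDbo_scale (ho : o ∈ M) (h3 : a₃ ∈ M) (hb : b ∈ M) :
    PDbo p ends o a₁ a₂ a₃ b = c * PDbo q ends' o a₁ a₂ a₃ b := by
  unfold PDbo
  rw [prob_PD_inter_scale h h3 (conn2_iff h h.mem₁ ho h.mem₁ hb),
    prob_PD_inter_scale h h3 (conn2_iff h h.mem₂ ho h.mem₁ hb),
    prob_PD_inter_scale h h3 (conn2_iff h h.mem₁ ho h.mem₂ hb),
    prob_PD_inter_scale h h3 (conn2_iff h h.mem₂ ho h.mem₂ hb)]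
  ring

omit [DecidableEq V] in
/-- `D_o = P(PD, o ∈ U)` scales. -/
lemma Do_scale (ho : o ∈ M) (h3 : a₃ ∈ M) :
    Do p ends o a₁ a₂ a₃ = c * Do q ends' o a₁ a₂ a₃ := by
  unfold Do
  rw [prob_PD_inter_scale h h3 (conn1_iff h h.mem₁ ho),
    prob_PD_inter_scale h h3 (conn1_iff h h.mem₂ ho)]
  ring

omit [DecidableEq V] in
/-- The gap scales (`gap_eq_Q`: it is the difference of two `Q`-restricted masses). -/
lemma gap_scale [LinearOrder R] [IsStrictOrderedRing R] (hb : b ∈ M) : gap p ends a₁ a₂ b = c * gap q ends' a₁ a₂ b := by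
  rw [gap_eq_Q, gap_eq_Q, prob_Q_inter_scale h (conn1_iff h h.mem₂ hb),
    prob_Q_inter_scale h (conn1_iff h h.mem₁ hb)]
  ring

omit [DecidableEq V] in
/-- `D · E_Q[F]` scales by `c²`. -/
lemma DEF_scale (ho : o ∈ M) (h3 : a₃ ∈ M) :
    DEF p ends o a₁ a₂ a₃ = c ^ 2 * DEF q ends' o a₁ a₂ a₃ := by
  unfold DEF
  rw [prob_PD_scale h h3, EQo_scale h ho, Do_scale h ho h3, EQ3_scale h h3, EQ3o_scale h ho h3]
  ring

omit [DecidableEq V] in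
/-- **Scaled transport of the covariance form**: `Gc p ends = c³ · Gc q ends'` for every
`Q`-killed reduction (`IsScaledTransport`) carrying the marks `o, a₃, b`. -/
theorem Gc_scale [LinearOrder R] [IsStrictOrderedRing R] (ho : o ∈ M) (h3 : a₃ ∈ M)
    (hb : b ∈ M) :
    Gc p ends o a₁ a₂ a₃ b = c ^ 3 * Gc q ends' o a₁ a₂ a₃ b := by
  unfold Gc
  rw [prob_Q_scale h, prob_PD_scale h h3, EQbo_scale h ho hb, Do_scale h ho h3,
    EQb3_scale h h3 hb, EQb3o_scale h ho h3 hb, gap_scale h hb, DEF_scale h ho h3,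
    PDb_scale h h3 hb, PDbo_scale h ho h3 hb]
  ring

end Masses

end Scale

end Summit.Ventures.PercRepro2
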